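import Summits.CriticalPhenomena.PercolationContinuityZ3.Theorems.Transplant.FKConnectivityAllQCountReweightedFKG
import Summits.CriticalPhenomena.PercolationContinuityZ3.Theorems.Transplant.FKConnectivityAllQArborealLimit
import Summits.CriticalPhenomena.PercolationContinuityZ3.Theorems.Transplant.FKConnectivityAllQArborealClusterTools
import HarnessLib

/-!
# On ACYCLIC supports, `μ_{w,h} ∝ P_w·h(k)` satisfies the FKG lattice condition and MM for every LOG-CONVEX `h` (monotone or not) —
# the sufficiency half matching `…CountReweightedNecessity` (the three-vertex path is a tree): on trees, MM_h ⟺ h log-convex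

Support file (`--supports stmt-CriticalPhenomena-4575`), FK sub-lane `prim-bschramm-fk-1` (gen 10) of the post-continuity programme;
builds on p205010 (kernel theorem, internal audit signed; external expert review pending).  No new definitions, no named facts, no
sorries; standard axioms.

MECHANISM.  If every pair of nonzero parameter lies in an acyclic set `T`, only forest configurations `ω ⊆ T` carry weight and there
`k(ω) = |V| − |ω|` (fk-1 g9's `card_le_card_add_clusterCount_and_iff`); the count weight is then a function of `|ω|` alone and, since
`|a ∪ b| + |a ∩ b| = |a| + |b|`, LOG-CONVEXITY of `h` is exactly the FKG lattice condition / Holley condition — with no monotonicity: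
* `crWeight_holley_forest` — Holley's condition between `w[f↦0]` and `w[f↦1]` (`f ∈ T`);
* **`mm_count_of_forest_support`** — MM: `μ_{w[f↦0],h}(C_x ∈ 𝒰) ≤ μ_{w[f↦1],h}(C_x ∈ 𝒰)` for every up-set `𝒰`, every pair `f` in the
  acyclic support (so also every log-convex DEcreasing `h`, e.g. the `q < 1` random-cluster weights on trees, where the measure is a
  product measure and the statement is classical; the point is the exact match with the necessary condition of `…CountReweightedNecessity`);
* `crWeight_lattice_forest` / **`crMeasure_fkg_of_forest_support`** — positive association on acyclic supports for log-convex `h`.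
[cite: Grimmett2006, Thm. (2.19) (p. 25); Thm. (3.8) (p. 39); §1.5 (p. 13)]
-/

noncomputable section

namespace Summit.CriticalPhenomena.PercolationContinuityZ3.Theorems

namespace FK

open MeasureTheory Set Literature.Probability.LatticeModels Literature.Probability.Percolation
open scoped Classical
open BHK2006 DecisionTree

variable {V : Type*} [Fintype V]

/-! ### Configurations inside an acyclic set -/

omit [Fintype V] in
/-- A sub-configuration of a forest configuration is a forest configuration. [folklore] -/
theorem isForestCfg_of_subset {T ω : BondConfig V} (hT : IsForestCfg T) (h : ω ⊆ T) : IsForestCfg ω :=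
  ⟨fun e he => hT.1 e (h he), hT.2.anti (openGraph_le h)⟩

/-- On forests `k(ω) + |ω| = |V|`. [cite: Grimmett2006, §1.5 (p. 13)] -/
theorem clusterCount_add_ncard_of_isForestCfg {ω : BondConfig V} (hω : IsForestCfg ω) :
    clusterCount ω ∅ + ω.ncard = Fintype.card V := by
  have hfin : ω.Finite := Set.toFinite ω
  have h := (card_le_card_add_clusterCount_and_iff hfin.toFinset).2.2 (by rw [Set.Finite.coe_toFinset]; exact hω)
  rw [Set.Finite.coe_toFinset, ← Set.ncard_eq_toFinset_card ω hfin] at h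
  omega

/-- If a pair of `ω` has parameter `0`, the count weight vanishes. [folklore] -/
private theorem crWeight_zero_of_mem (u : Sym2 V → unitInterval) (h : ℕ → ℝ) {ω : BondConfig V} {e : Sym2 V} (he : e ∈ ω)
    (hu : u e = 0) : crWeight u h ω = 0 := by
  unfold crWeight
  rw [weight_eq_factor_mul _ e, if_pos he]
  simp [hu]

/-- If a pair outside `ω` has parameter `1`, the count weight vanishes. [folklore] -/
private theorem crWeight_zero_of_not_mem (u : Sym2 V → unitInterval) (h : ℕ → ℝ) {ω : BondConfig V} {e : Sym2 V} (he : e ∉ ω)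
    (hu : u e = 1) : crWeight u h ω = 0 := by
  unfold crWeight
  rw [weight_eq_factor_mul _ e, if_neg he]
  simp [hu]

omit [Fintype V] in
/-- The coordinates of `w` lie in `[0, 1]`. [folklore] -/
private theorem cw0 (w : Sym2 V → unitInterval) (e : Sym2 V) : 0 ≤ (w e : ℝ) := (w e).2.1

omit [Fintype V] in
/-- The coordinates of `w` lie in `[0, 1]`. [folklore] -/
private theorem cw1 (w : Sym2 V → unitInterval) (e : Sym2 V) : (w e : ℝ) ≤ 1 := (w e).2.2

/-- **The `h`-inequality on forests**: for `a, b ⊆ T` acyclic and `h` positive log-convex,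
`h(k a)·h(k b) ≤ h(k(a ∩ b))·h(k(a ∪ b))`. [cite: Grimmett2006, Thm. (3.8) eq. (3.12) (p. 39)] -/
theorem h_clusterCount_le_of_forest {h : ℕ → ℝ} (hpos : ∀ k, 0 < h k) (hlc : ∀ j, h (j + 1) * h (j + 1) ≤ h j * h (j + 2))
    {T a b : BondConfig V} (hT : IsForestCfg T) (ha : a ⊆ T) (hb : b ⊆ T) :
    h (clusterCount a ∅) * h (clusterCount b ∅) ≤ h (clusterCount (a ∩ b) ∅) * h (clusterCount (a ∪ b) ∅) := by
  have ka := clusterCount_add_ncard_of_isForestCfg (isForestCfg_of_subset hT ha)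
  have kb := clusterCount_add_ncard_of_isForestCfg (isForestCfg_of_subset hT hb)
  have hiT : a ∩ b ⊆ T := fun e he => ha he.1
  have ki := clusterCount_add_ncard_of_isForestCfg (isForestCfg_of_subset hT hiT)
  have ku := clusterCount_add_ncard_of_isForestCfg (isForestCfg_of_subset hT (Set.union_subset ha hb))
  have hcard := Set.ncard_union_add_ncard_inter a b (Set.toFinite a) (Set.toFinite b)
  have hbU : b.ncard ≤ (a ∪ b).ncard := Set.ncard_le_ncard Set.subset_union_right (Set.toFinite _)
  have haU : a.ncard ≤ (a ∪ b).ncard := Set.ncard_le_ncard Set.subset_union_left (Set.toFinite _)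
  have eA : clusterCount a ∅ = Fintype.card V - a.ncard := Nat.eq_sub_of_add_eq ka
  have eB : clusterCount b ∅ = Fintype.card V - b.ncard := Nat.eq_sub_of_add_eq kb
  have eI : clusterCount (a ∩ b) ∅ = Fintype.card V - (a ∩ b).ncard := Nat.eq_sub_of_add_eq ki
  have eU : clusterCount (a ∪ b) ∅ = Fintype.card V - (a ∪ b).ncard := Nat.eq_sub_of_add_eq ku
  have hUn : (a ∪ b).ncard ≤ Fintype.card V := by rw [← ku]; exact Nat.le_add_left _ _
  rw [eA, eB, eI, eU]
  have hUb : Fintype.card V - (a ∪ b).ncard ≤ Fintype.card V - b.ncard := Nat.sub_le_sub_left hbU _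
  have key := logConvex_shift_le hpos hlc hUb ((a ∪ b).ncard - a.ncard)
  have e1 : Fintype.card V - (a ∪ b).ncard + ((a ∪ b).ncard - a.ncard) = Fintype.card V - a.ncard := by omega
  have e2 : Fintype.card V - b.ncard + ((a ∪ b).ncard - a.ncard) = Fintype.card V - (a ∩ b).ncard := by omega
  rw [e1, e2] at key
  linarith [key, mul_comm (h (Fintype.card V - (a ∩ b).ncard)) (h (Fintype.card V - (a ∪ b).ncard))]

/-! ### Holley between the two revealed worlds, MM, and FKG on acyclic supports -/

/-- Product part of Holley's condition for `u₀ ≤ u₁` pointwise. [cite: Grimmett2006, Thm. (3.21) (proof) (p. 43)] -/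
private theorem weight_holley_of_le {u₀ u₁ : Sym2 V → unitInterval} (hle : ∀ e, u₀ e ≤ u₁ e) (a b : BondConfig V) :
    weight (fun e => (u₀ e : ℝ)) a * weight (fun e => (u₁ e : ℝ)) b ≤
      weight (fun e => (u₀ e : ℝ)) (a ⊓ b) * weight (fun e => (u₁ e : ℝ)) (a ⊔ b) := by
  unfold weight
  rw [← Finset.prod_mul_distrib, ← Finset.prod_mul_distrib]
  refine Finset.prod_le_prod (fun e _ => ?_) fun e _ => ?_
  · refine mul_nonneg ?_ ?_ <;> split_ifs <;> linarith [cw0 u₀ e, cw1 u₀ e, cw0 u₁ e, cw1 u₁ e]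
  · have hwe : (u₀ e : ℝ) ≤ u₁ e := hle e
    by_cases ha : e ∈ a <;> by_cases hb : e ∈ b <;>
      simp only [ha, hb, Set.inf_eq_inter, Set.sup_eq_union, Set.mem_inter_iff, Set.mem_union, if_true, if_false, and_true,
        and_false, or_true, or_false, le_refl]
    nlinarith [cw0 u₀ e, cw1 u₁ e]

/-- **Holley's condition between `w[f↦0]` and `w[f↦1]` on an acyclic support** (`h` positive log-convex; `w` vanishes off the
acyclic set `T ∋ f`). [cite: Grimmett2006, Thm. (2.1) (p. 20); Thm. (3.21) (proof) (p. 43)] -/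
theorem crWeight_holley_forest {h : ℕ → ℝ} (hpos : ∀ k, 0 < h k) (hlc : ∀ j, h (j + 1) * h (j + 1) ≤ h j * h (j + 2))
    {T : BondConfig V} (hT : IsForestCfg T) {w : Sym2 V → unitInterval} (hw : ∀ e, e ∉ T → w e = 0) {f : Sym2 V} (hf : f ∈ T)
    (a b : BondConfig V) :
    crWeight (Function.update w f 0) h a * crWeight (Function.update w f 1) h b ≤
      crWeight (Function.update w f 0) h (a ⊓ b) * crWeight (Function.update w f 1) h (a ⊔ b) := by
  set u0 := Function.update w f 0 with hu0
  set u1 := Function.update w f 1 with hu1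
  have h00 : 0 ≤ crWeight u0 h (a ⊓ b) * crWeight u1 h (a ⊔ b) :=
    mul_nonneg (crWeight_nonneg u0 (fun k => (hpos k).le) _) (crWeight_nonneg u1 (fun k => (hpos k).le) _)
  by_cases hfb : f ∈ b
  swap
  · rw [crWeight_zero_of_not_mem u1 h hfb (by rw [hu1, Function.update_self]), mul_zero]; exact h00
  by_cases hfa : f ∈ a
  · rw [crWeight_zero_of_mem u0 h hfa (by rw [hu0, Function.update_self]), zero_mul]; exact h00
  by_cases haT : a ⊆ T
  swap
  · obtain ⟨e, hea, heT⟩ := Set.not_subset.1 haT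
    have hef : e ≠ f := fun h' => heT (h' ▸ hf)
    rw [crWeight_zero_of_mem u0 h hea (by rw [hu0, Function.update_of_ne hef]; exact hw e heT), zero_mul]; exact h00
  by_cases hbT : b ⊆ T
  swap
  · obtain ⟨e, heb, heT⟩ := Set.not_subset.1 hbT
    have hef : e ≠ f := fun h' => heT (h' ▸ hf)
    rw [crWeight_zero_of_mem u1 h heb (by rw [hu1, Function.update_of_ne hef]; exact hw e heT), mul_zero]; exact h00
  -- main case: `f ∉ a ⊆ T`, `f ∈ b ⊆ T`
  have hle : ∀ e, u0 e ≤ u1 e := fun e => by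
    by_cases he : e = f
    · rw [he, hu0, hu1, Function.update_self, Function.update_self]; exact unitInterval.nonneg _
    · rw [hu0, hu1, Function.update_of_ne he, Function.update_of_ne he]
  have hprod := weight_holley_of_le hle a b
  have hh := h_clusterCount_le_of_forest hpos hlc hT haT hbT
  have h0 : 0 ≤ weight (fun e => (u0 e : ℝ)) (a ⊓ b) * weight (fun e => (u1 e : ℝ)) (a ⊔ b) :=
    mul_nonneg (weight_nonneg (cw0 u0) (cw1 u0) _) (weight_nonneg (cw0 u1) (cw1 u1) _)
  have h0' : 0 ≤ h (clusterCount a ∅) * h (clusterCount b ∅) := mul_nonneg (hpos _).le (hpos _).le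
  unfold crWeight
  calc weight (fun e => (u0 e : ℝ)) a * h (clusterCount a ∅) * (weight (fun e => (u1 e : ℝ)) b * h (clusterCount b ∅))
      = (weight (fun e => (u0 e : ℝ)) a * weight (fun e => (u1 e : ℝ)) b) * (h (clusterCount a ∅) * h (clusterCount b ∅)) := by ring
    _ ≤ (weight (fun e => (u0 e : ℝ)) (a ⊓ b) * weight (fun e => (u1 e : ℝ)) (a ⊔ b)) *
          (h (clusterCount (a ⊓ b) ∅) * h (clusterCount (a ⊔ b) ∅)) := mul_le_mul hprod hh h0' h0
    _ = _ := by ring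

/-- **MM on acyclic supports for every log-convex count weight**: if `w` vanishes off an acyclic set `T ∋ f = s(x,z)` and `h` is
positive log-convex (monotone or not), then `μ_{w[f↦0],h}(C_x ∈ 𝒰) ≤ μ_{w[f↦1],h}(C_x ∈ 𝒰)` for every up-set `𝒰` (Holley).
[cite: Grimmett2006, Thm. (2.1) (p. 20); Thm. (3.21) (p. 43)] -/
theorem mm_count_of_forest_support {h : ℕ → ℝ} (hpos : ∀ k, 0 < h k) (hlc : ∀ j, h (j + 1) * h (j + 1) ≤ h j * h (j + 2))
    {T : BondConfig V} (hT : IsForestCfg T) {w : Sym2 V → unitInterval} (hw : ∀ e, e ∉ T → w e = 0) {x z : V} (hf : s(x, z) ∈ T)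
    {𝒰 : Set (Set V)} (h𝒰 : IsUpperSet 𝒰) :
    (crMeasure (Function.update w s(x, z) 0) h).real (clusterIn x 𝒰) ≤ (crMeasure (Function.update w s(x, z) 1) h).real (clusterIn x 𝒰) := by
  set u0 := Function.update w s(x, z) 0
  set u1 := Function.update w s(x, z) 1
  have hZ₁ := crPartition_pos u0 hpos
  have hZ₂ := crPartition_pos u1 hpos
  set f : BondConfig V → ℝ := fun ω => crWeight u0 h ω / crPartition u0 h with hfdef
  set g : BondConfig V → ℝ := fun ω => crWeight u1 h ω / crPartition u1 h with hgdef
  have hf0 : 0 ≤ f := fun ω => div_nonneg (crWeight_nonneg u0 (fun k => (hpos k).le) ω) hZ₁.le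
  have hg0 : 0 ≤ g := fun ω => div_nonneg (crWeight_nonneg u1 (fun k => (hpos k).le) ω) hZ₂.le
  have hfg : ∑ ω, f ω = ∑ ω, g ω := by
    simp only [hfdef, hgdef, ← Finset.sum_div]
    change crPartition u0 h / _ = crPartition u1 h / _
    rw [div_self hZ₁.ne', div_self hZ₂.ne']
  have hcond : ∀ a b, f a * g b ≤ f (a ⊓ b) * g (a ⊔ b) := fun a b => by
    simp only [hfdef, hgdef, div_mul_div_comm]
    exact div_le_div_of_nonneg_right (crWeight_holley_forest hpos hlc hT hw hf a b) (mul_pos hZ₁ hZ₂).le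
  have hmono : Monotone (ind (clusterIn x 𝒰)) := fun a b hab => by
    by_cases ha : a ∈ clusterIn x 𝒰
    · rw [ind_of_mem ha, ind_of_mem (isUpperSet_clusterIn x h𝒰 hab ha)]
    · rw [ind_of_not_mem ha]; exact ind_nonneg _ b
  have key := holley (μ := ind (clusterIn x 𝒰)) f g (fun ω => ind_nonneg _ ω) hf0 hg0 hmono hfg hcond
  rw [crMeasure_real_eq_sum_div u0 hpos, crMeasure_real_eq_sum_div u1 hpos, Finset.sum_div, Finset.sum_div]
  calc ∑ ω, crWeight u0 h ω * ind (clusterIn x 𝒰) ω / crPartition u0 h = ∑ ω, ind (clusterIn x 𝒰) ω * f ω :=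
        Finset.sum_congr rfl fun ω _ => by simp only [hfdef]; ring
    _ ≤ ∑ ω, ind (clusterIn x 𝒰) ω * g ω := key
    _ = _ := Finset.sum_congr rfl fun ω _ => by simp only [hgdef]; ring

/-- **FKG lattice condition on acyclic supports for every log-convex count weight** (no monotonicity needed).
[cite: Grimmett2006, Thm. (3.8) eqs. (3.11)–(3.12) (p. 39)] -/
theorem crWeight_lattice_forest {h : ℕ → ℝ} (hpos : ∀ k, 0 < h k) (hlc : ∀ j, h (j + 1) * h (j + 1) ≤ h j * h (j + 2))
    {T : BondConfig V} (hT : IsForestCfg T) {w : Sym2 V → unitInterval} (hw : ∀ e, e ∉ T → w e = 0) (a b : BondConfig V) :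
    crWeight w h a * crWeight w h b ≤ crWeight w h (a ⊓ b) * crWeight w h (a ⊔ b) := by
  have h00 : 0 ≤ crWeight w h (a ⊓ b) * crWeight w h (a ⊔ b) :=
    mul_nonneg (crWeight_nonneg w (fun k => (hpos k).le) _) (crWeight_nonneg w (fun k => (hpos k).le) _)
  by_cases haT : a ⊆ T
  swap
  · obtain ⟨e, hea, heT⟩ := Set.not_subset.1 haT
    rw [crWeight_zero_of_mem w h hea (hw e heT), zero_mul]; exact h00
  by_cases hbT : b ⊆ T
  swap
  · obtain ⟨e, heb, heT⟩ := Set.not_subset.1 hbT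
    rw [crWeight_zero_of_mem w h heb (hw e heT), mul_zero]; exact h00
  have hprod := weight_inter_mul_union (fun e => (w e : ℝ)) a b
  have hh := h_clusterCount_le_of_forest hpos hlc hT haT hbT
  have h0 : 0 ≤ weight (fun e => (w e : ℝ)) (a ∩ b) * weight (fun e => (w e : ℝ)) (a ∪ b) :=
    mul_nonneg (weight_nonneg (cw0 w) (cw1 w) _) (weight_nonneg (cw0 w) (cw1 w) _)
  unfold crWeight
  calc weight (fun e => (w e : ℝ)) a * h (clusterCount a ∅) * (weight (fun e => (w e : ℝ)) b * h (clusterCount b ∅))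
      = (weight (fun e => (w e : ℝ)) (a ∩ b) * weight (fun e => (w e : ℝ)) (a ∪ b)) * (h (clusterCount a ∅) * h (clusterCount b ∅)) := by
        rw [← hprod]; ring
    _ ≤ (weight (fun e => (w e : ℝ)) (a ∩ b) * weight (fun e => (w e : ℝ)) (a ∪ b)) *
          (h (clusterCount (a ∩ b) ∅) * h (clusterCount (a ∪ b) ∅)) := mul_le_mul_of_nonneg_left hh h0
    _ = _ := by simp only [Set.inf_eq_inter, Set.sup_eq_union]; ring

omit [Fintype V] in
/-- The real indicator of an increasing event is monotone. [folklore] -/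
private theorem ind_monotone_of_isUpperSet'' {A : Set (BondConfig V)} (hA : IsUpperSet A) : Monotone (ind A) := by
  intro a b hab
  by_cases ha : a ∈ A
  · rw [ind_of_mem ha, ind_of_mem (hA hab ha)]
  · rw [ind_of_not_mem ha]; exact ind_nonneg A b

/-- **Positive association on acyclic supports for every log-convex count weight**: `μ(A)μ(A') ≤ μ(A ∩ A')` for increasing events.
[cite: Grimmett2006, Thm. (2.19) (p. 25); Thm. (3.8) (p. 39)] -/
theorem crMeasure_fkg_of_forest_support {h : ℕ → ℝ} (hpos : ∀ k, 0 < h k) (hlc : ∀ j, h (j + 1) * h (j + 1) ≤ h j * h (j + 2))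
    {T : BondConfig V} (hT : IsForestCfg T) {w : Sym2 V → unitInterval} (hw : ∀ e, e ∉ T → w e = 0)
    {A A' : Set (BondConfig V)} (hA : IsUpperSet A) (hA' : IsUpperSet A') :
    (crMeasure w h).real A * (crMeasure w h).real A' ≤ (crMeasure w h).real (A ∩ A') := by
  have hZ := crPartition_pos w hpos
  have key := fkg (μ := crWeight w h) (f := ind A) (g := ind A') (fun ω => crWeight_nonneg w (fun k => (hpos k).le) ω)
    (fun ω => ind_nonneg A ω) (fun ω => ind_nonneg A' ω) (ind_monotone_of_isUpperSet'' hA) (ind_monotone_of_isUpperSet'' hA')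
    (crWeight_lattice_forest hpos hlc hT hw)
  have hAA : ∀ ω, ind A ω * ind A' ω = ind (A ∩ A') ω := fun ω => (BHK2006.ind_inter A A' ω).symm
  simp only [hAA] at key
  rw [crMeasure_real_eq_sum_div w hpos A, crMeasure_real_eq_sum_div w hpos A', crMeasure_real_eq_sum_div w hpos (A ∩ A'),
    div_mul_div_comm, div_le_div_iff₀ (mul_pos hZ hZ) hZ]
  calc (∑ ω, crWeight w h ω * ind A ω) * (∑ ω, crWeight w h ω * ind A' ω) * crPartition w h
      ≤ (crPartition w h * ∑ ω, crWeight w h ω * ind (A ∩ A') ω) * crPartition w h := mul_le_mul_of_nonneg_right key hZ.le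
    _ = _ := by ring

end FK

end Summit.CriticalPhenomena.PercolationContinuityZ3.Theorems

end
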